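import Literature.Analysis.Convolution.ScaledMollifier
import HarnessLib

/-!
# `L²` bounds for kernel operators dominated by a convolution: the derivative `D(J_ε f)` and the
# commutator `[J_ε, a]` (Alinhac's commutation estimate, zeroth-order form)

Analysis/Convolution support file (everything proved, no named facts), second layer of the
mollifier toolkit for the existence of smooth solutions of linear hyperbolic equations by the
regularised evolution (S. Alinhac, *Hyperbolic Partial Differential Equations* (2009), Thm. 7.11).
The uniform-in-`ε` energy estimate for the regularised equation rests on two `L²` facts about the
smoothing operators `C_ε = J_ε` (Alinhac, proof of Thm. 7.11, Step 1 and Lemma 7.12, pp. 93–94):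
the derivative `∂_i C_ε` costs `ε⁻¹` in `L²`, while commuting `C_ε` past a Lipschitz coefficient
gains a factor `ε` (the commutator `[C_ε, A]` "can be explicitly written
`∫ φ_ε(x − y)[A(y) − A(x)] v(y) dy`" with `|A(y) − A(x)| ≤ ‖∇A‖_∞ |x − y| ≤ 2ε‖∇A‖_∞` on the
support of `φ_ε(x − y)`; this is the part of Alinhac's Lemma 7.12 without the derivative, which is
all the doubly-regularised scheme `∂_t u = J_ε(A J_ε u)` needs). Both are instances of one
principle, proved first:

* `integral_sq_norm_le_of_norm_le_convolution` — **domination by a convolution**: if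
  `‖g(x)‖ ≤ (k ⋆ ‖f‖)(x)` pointwise for a continuous compactly supported kernel `k ≥ 0` of mass
  `M = ∫ k` and `f ∈ L²`, then `g ∈ L²` with `∫ ‖g‖² ≤ M² ∫ ‖f‖²` (Jensen for the probability kernel
  `k/M`, the tree's `FluidPDE.memLp_two_convolution`; Schur's test for translation-invariant
  majorants);
* `integral_sq_norm_fderiv_mollify_le` — **`‖∂_a J_ε f‖_{L²} ≤ ε⁻¹ K ‖a‖ ‖f‖_{L²}`**
  (`K = mollifierGradMass E = ∫ ‖Dρ₁‖`), from `∂_a J_ε f = (∂_aρ_ε) ⋆ f` and `∫ ‖Dρ_ε‖ = ε⁻¹K`;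
* `mollify_smul_sub_smul_mollify` and `integral_sq_norm_commutator_le` — **the commutator**
  `J_ε(a f)(x) − a(x) J_ε f(x) = ∫ ρ_ε(x − y)(a(y) − a(x)) f(y) dy` and
  `‖[J_ε, a] f‖_{L²} ≤ 2εL ‖f‖_{L²}` whenever `‖a(y) − a(x)‖ ≤ L‖x − y‖` for `y` in the support of
  `f` and `‖x − y‖ < 2ε` (a local Lipschitz hypothesis, which is what smooth coefficients supply
  on compact sets).

## Mathlib / tree search

Mathlib (this pin): convolution API, `MemLp`, no Schur test / commutator estimates for mollifiers
(`lean search 'commutator.*convolution|Friedrichs'`: only fluid-specific tree files on the torus,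
`FunctionSpaces/TorusCommutatorEstimate`). Tree: `FluidPDE.MollifiedField.memLp_two_convolution`
(Jensen bound for probability kernels) is the engine; `Convolution/ScaledMollifier` (previous
layer) supplies `ρ_ε`, `J_ε`, `fderiv_mollify_apply`, `integral_norm_fderiv_mollifier`.

## References

* S. Alinhac, *Hyperbolic Partial Differential Equations*, Springer (2009), §7.6, proof of
  Thm. 7.11, Step 1, Lemma 7.12 (commutation lemma) and Step 2 (a), (c) (held text pp. 93–94).
  [`AlinhacHPDE2009`]
-/

noncomputable section

open MeasureTheory Set Function Filter Metric Module ContinuousLinearMap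
open scoped Convolution ContDiff Topology Pointwise

namespace Literature.Analysis.Convolution

variable {E : Type*} [NormedAddCommGroup E] [InnerProductSpace ℝ E] [FiniteDimensional ℝ E]
  [MeasurableSpace E] [BorelSpace E]
variable {F : Type*} [NormedAddCommGroup F] [NormedSpace ℝ F]
variable {F' : Type*} [NormedAddCommGroup F']

/-! ### Domination by a convolution with a nonnegative kernel -/

omit [NormedSpace ℝ F] in
/-- **`L²` bound by domination (Schur / Jensen)**: if `‖g(x)‖ ≤ (k ⋆ ‖f‖)(x)` for every `x`, where
`k ≥ 0` is a continuous compactly supported kernel of mass `M = ∫ k` and `f ∈ L²`, and `g` is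
a.e.-strongly measurable, then `‖g‖² ` is integrable and `∫ ‖g‖² ≤ M² ∫ ‖f‖²`. Proof: for `M > 0`
the kernel `k/M` is a probability density, so Jensen's inequality (`memLp_two_convolution`) gives
`∫ ((k/M) ⋆ ‖f‖)² ≤ ∫ ‖f‖²`; for `M = 0` the kernel and hence `g` vanish. [folklore] -/
theorem integral_sq_norm_le_of_norm_le_convolution {k : E → ℝ} (hk : Continuous k)
    (hkc : HasCompactSupport k) (hk0 : ∀ y, 0 ≤ k y) {f : E → F} (hf : MemLp f 2 volume)
    {g : E → F'} (hg : AEStronglyMeasurable g volume)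
    (hdom : ∀ x, ‖g x‖ ≤ (k ⋆[lsmul ℝ ℝ, volume] fun y => ‖f y‖) x) :
    Integrable (fun x => ‖g x‖ ^ 2) volume ∧
      ∫ x, ‖g x‖ ^ 2 ≤ (∫ y, k y) ^ 2 * ∫ y, ‖f y‖ ^ 2 := by
  set M : ℝ := ∫ y, k y with hM
  have hM0 : 0 ≤ M := integral_nonneg hk0
  have hfn : MemLp (fun y => ‖f y‖) 2 volume := hf.norm
  have hf2 : ∫ y, ‖(fun y => ‖f y‖) y‖ ^ 2 = ∫ y, ‖f y‖ ^ 2 := by simp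
  rcases hM0.eq_or_lt with hM00 | hMpos
  · -- `M = 0`: the kernel vanishes identically, hence so do the convolution and `g`
    have hkz : k = 0 := by
      have hint : ∫ y, k y = 0 := hM00.symm
      have hki : Integrable k volume := hk.integrable_of_hasCompactSupport hkc
      have hae := (integral_eq_zero_iff_of_nonneg (fun y => hk0 y) hki).1 hint
      exact hk.ae_eq_iff_eq volume continuous_const |>.1 hae
    have hg0 : ∀ x, g x = 0 := fun x => by
      have h := hdom x
      rw [hkz, zero_convolution] at h
      exact norm_le_zero_iff.1 h
    refine ⟨?_, ?_⟩
    · have : (fun x => ‖g x‖ ^ 2) = fun _ => (0 : ℝ) := by funext x; simp [hg0 x]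
      rw [this]; exact integrable_zero _ _ _
    · have h1 : ∫ x, ‖g x‖ ^ 2 = 0 := by simp [hg0]
      rw [h1]
      exact mul_nonneg (sq_nonneg _) (integral_nonneg fun _ => sq_nonneg _)
  · -- `M > 0`: normalise the kernel
    set ρ : E → ℝ := fun y => M⁻¹ * k y with hρ
    have hρc : Continuous ρ := continuous_const.mul hk
    have hρs : HasCompactSupport ρ := hkc.mul_left
    have hρ0 : ∀ y, 0 ≤ ρ y := fun y => mul_nonneg (inv_nonneg.2 hM0) (hk0 y)
    have hρ1 : ∫ y, ρ y = 1 := by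
      rw [hρ]; simp only
      rw [integral_const_mul, ← hM, inv_mul_cancel₀ hMpos.ne']
    obtain ⟨hmem, hJ⟩ := FluidPDE.memLp_two_convolution hρc hρs hρ0 hρ1 hfn
    rw [hf2] at hJ
    -- `k ⋆ ‖f‖ = M · (ρ ⋆ ‖f‖)`
    have hkρ : (k ⋆[lsmul ℝ ℝ, volume] fun y => ‖f y‖) =
        fun x => M * (ρ ⋆[lsmul ℝ ℝ, volume] fun y => ‖f y‖) x := by
      have hk' : k = M • ρ := by
        funext y; rw [hρ]; simp only [Pi.smul_apply, smul_eq_mul]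
        rw [← mul_assoc, mul_inv_cancel₀ hMpos.ne', one_mul]
      rw [hk', smul_convolution]
      rfl
    have hdom' : ∀ x, ‖g x‖ ^ 2 ≤ M ^ 2 * ‖(ρ ⋆[lsmul ℝ ℝ, volume] fun y => ‖f y‖) x‖ ^ 2 := by
      intro x
      have h := hdom x
      rw [hkρ] at h
      have hx0 : 0 ≤ ‖g x‖ := norm_nonneg _
      calc ‖g x‖ ^ 2 ≤ (M * (ρ ⋆[lsmul ℝ ℝ, volume] fun y => ‖f y‖) x) ^ 2 :=
            pow_le_pow_left₀ hx0 h 2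
        _ ≤ M ^ 2 * ‖(ρ ⋆[lsmul ℝ ℝ, volume] fun y => ‖f y‖) x‖ ^ 2 := by
            rw [mul_pow, Real.norm_eq_abs, sq_abs]
    have hint2 : Integrable (fun x => ‖(ρ ⋆[lsmul ℝ ℝ, volume] fun y => ‖f y‖) x‖ ^ 2) volume :=
      (memLp_two_iff_integrable_sq_norm hmem.1).1 hmem
    have hgi : Integrable (fun x => ‖g x‖ ^ 2) volume := by
      refine (hint2.const_mul (M ^ 2)).mono' (hg.norm.pow 2) (ae_of_all _ fun x => ?_)
      rw [Real.norm_of_nonneg (sq_nonneg _)]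
      exact hdom' x
    refine ⟨hgi, ?_⟩
    calc ∫ x, ‖g x‖ ^ 2 ≤ ∫ x, M ^ 2 * ‖(ρ ⋆[lsmul ℝ ℝ, volume] fun y => ‖f y‖) x‖ ^ 2 :=
          integral_mono hgi (hint2.const_mul _) hdom'
      _ = M ^ 2 * ∫ x, ‖(ρ ⋆[lsmul ℝ ℝ, volume] fun y => ‖f y‖) x‖ ^ 2 := integral_const_mul _ _
      _ ≤ M ^ 2 * ∫ y, ‖f y‖ ^ 2 := mul_le_mul_of_nonneg_left hJ (sq_nonneg _)

/-! ### The derivative of a mollified `L²` function -/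

/-- Pointwise domination of the derivative: `‖D(J_ε f)(x) a‖ ≤ ((‖a‖ ‖Dρ_ε‖) ⋆ ‖f‖)(x)`.
[cite: AlinhacHPDE2009, Thm. 7.11 proof Step 2 (a)] -/
theorem norm_fderiv_mollify_apply_le_convolution (ε : ℝ) {f : E → F}
    (hf : LocallyIntegrable f volume) (x a : E) :
    ‖fderiv ℝ (mollify ε f) x a‖ ≤
      ((fun z => ‖a‖ * ‖fderiv ℝ (mollifier ε : E → ℝ) z‖) ⋆[lsmul ℝ ℝ, volume]
        fun y => ‖f y‖) x := by
  rw [fderiv_mollify_apply ε hf x a, convolution_lsmul_swap]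
  have hcont : Continuous fun y : E => ‖a‖ * ‖fderiv ℝ (mollifier ε : E → ℝ) (x - y)‖ :=
    continuous_const.mul
      ((continuous_fderiv_mollifier ε).norm.comp (continuous_const.sub continuous_id))
  have hcs : HasCompactSupport fun y : E => ‖a‖ * ‖fderiv ℝ (mollifier ε : E → ℝ) (x - y)‖ :=
    ((hasCompactSupport_fderiv_mollifier ε).norm.comp_homeomorph
      (Homeomorph.subLeft x)).mul_left
  have hfn : LocallyIntegrable (fun y => ‖f y‖) volume :=
    hf.mono hf.aestronglyMeasurable.norm (ae_of_all _ fun y => by simp)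
  have hint : Integrable
      (fun y : E => (‖a‖ * ‖fderiv ℝ (mollifier ε : E → ℝ) (x - y)‖) * ‖f y‖) volume :=
    hfn.integrable_smul_left_of_hasCompactSupport hcont hcs
  calc ‖∫ y, (fderiv ℝ (mollifier ε) (x - y) a) • f y‖
      ≤ ∫ y, (‖a‖ * ‖fderiv ℝ (mollifier ε : E → ℝ) (x - y)‖) * ‖f y‖ := by
        refine norm_integral_le_of_norm_le hint (ae_of_all _ fun y => ?_)
        rw [norm_smul]
        refine mul_le_mul_of_nonneg_right ?_ (norm_nonneg _)
        rw [mul_comm]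
        exact le_opNorm _ _
    _ = ∫ y, (‖a‖ * ‖fderiv ℝ (mollifier ε : E → ℝ) (x - y)‖) • ‖f y‖ := by
        simp only [smul_eq_mul]

/-- **`L²` cost of one derivative on `J_ε`**: for `f ∈ L²` and a direction `a`,
`∫ ‖D(J_ε f)(x) a‖² dx ≤ (ε⁻¹ K ‖a‖)² ∫ ‖f‖²`, `K = mollifierGradMass E` (Alinhac 2009, proof of
Thm. 7.11: `∂_i C_ε` is, for fixed `ε`, bounded, through the kernel `ε^{-n-1}(∂_iφ)(·/ε)` of mass
`ε⁻¹ ∫ |∂_iφ|`). [cite: AlinhacHPDE2009, Thm. 7.11 proof Step 2 (a)] -/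
theorem integral_sq_norm_fderiv_mollify_le {ε : ℝ} (hε : 0 < ε) {f : E → F}
    (hf : MemLp f 2 volume) (a : E) :
    Integrable (fun x => ‖fderiv ℝ (mollify ε f) x a‖ ^ 2) volume ∧
      ∫ x, ‖fderiv ℝ (mollify ε f) x a‖ ^ 2 ≤
        (ε⁻¹ * mollifierGradMass E * ‖a‖) ^ 2 * ∫ y, ‖f y‖ ^ 2 := by
  have hfl : LocallyIntegrable f volume := hf.locallyIntegrable one_le_two
  have hk : Continuous fun z : E => ‖a‖ * ‖fderiv ℝ (mollifier ε : E → ℝ) z‖ :=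
    continuous_const.mul (continuous_fderiv_mollifier ε).norm
  have hkc : HasCompactSupport fun z : E => ‖a‖ * ‖fderiv ℝ (mollifier ε : E → ℝ) z‖ :=
    (hasCompactSupport_fderiv_mollifier ε).norm.mul_left
  have hk0 : ∀ z : E, 0 ≤ ‖a‖ * ‖fderiv ℝ (mollifier ε : E → ℝ) z‖ := fun z => by positivity
  have hg : AEStronglyMeasurable (fun x => fderiv ℝ (mollify ε f) x a) volume := by
    have hc : ContDiff ℝ 1 (mollify ε f) := contDiff_mollify ε hfl
    exact ((hc.continuous_fderiv (by simp)).clm_apply continuous_const).aestronglyMeasurable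
  obtain ⟨hi, hle⟩ := integral_sq_norm_le_of_norm_le_convolution hk hkc hk0 hf hg
    (fun x => norm_fderiv_mollify_apply_le_convolution ε hfl x a)
  refine ⟨hi, hle.trans_eq ?_⟩
  rw [integral_const_mul, integral_norm_fderiv_mollifier hε]
  ring

/-! ### The commutator of `J_ε` with a multiplication -/

/-- **The commutator as an integral**: for a continuous coefficient `a`, locally integrable `f`
with `a • f` locally integrable,
`J_ε(a f)(x) − a(x) J_ε f(x) = ∫ ρ_ε(x − y) (a(y) − a(x)) f(y) dy` (Alinhac 2009, proof of
Lemma 7.12: "The commutator can be explicitly written `∫ φ_ε(x−y)[A(y)−A(x)]∂_jv(y)dy`", here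
without the derivative). [cite: AlinhacHPDE2009, Lemma 7.12] -/
theorem mollify_smul_sub_smul_mollify (ε : ℝ) {a : E → ℝ} {f : E → F}
    (hf : LocallyIntegrable f volume) (haf : LocallyIntegrable (fun y => a y • f y) volume)
    (x : E) :
    mollify ε (fun y => a y • f y) x - a x • mollify ε f x =
      ∫ y, (mollifier ε (x - y) * (a y - a x)) • f y := by
  rw [mollify_apply', mollify_apply']
  have hρx : Continuous fun y : E => mollifier ε (x - y) :=
    (continuous_mollifier ε).comp (continuous_const.sub continuous_id)
  have hρxc : HasCompactSupport fun y : E => mollifier ε (x - y) :=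
    (hasCompactSupport_mollifier ε).comp_homeomorph (Homeomorph.subLeft x)
  have i1 : Integrable (fun y => mollifier ε (x - y) • (a y • f y)) volume :=
    haf.integrable_smul_left_of_hasCompactSupport hρx hρxc
  have i2 : Integrable (fun y => mollifier ε (x - y) • f y) volume :=
    hf.integrable_smul_left_of_hasCompactSupport hρx hρxc
  have i2' : Integrable (fun y => a x • (mollifier ε (x - y) • f y)) volume := i2.smul (a x)
  rw [← integral_smul, ← integral_sub i1 i2']
  refine integral_congr_ae (ae_of_all _ fun y => ?_)
  simp only [smul_smul]
  rw [← sub_smul]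
  congr 1
  ring

/-- **`L²` bound for the commutator `[J_ε, a]`** (zeroth-order commutation estimate): if
`‖a(y) − a(x)‖ ≤ L ‖x − y‖` whenever `y ∈ tsupport f` and `‖x − y‖ < 2ε` (a Lipschitz bound on the
`2ε`-neighbourhood of the support of `f`), `L ≥ 0`, and `f ∈ L²` with `a • f ∈ L¹_loc`, then
`∫ ‖J_ε(a f) − a J_ε f‖² ≤ (2εL)² ∫ ‖f‖²`: on the support of `ρ_ε(x − y)` one has `‖x − y‖ < 2ε`,
so the commutator is dominated by the convolution of `‖f‖` with `2εL ρ_ε` (mass `2εL`)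
(Alinhac 2009, Lemma 7.12, the estimate of the second integral: "`A(y) − A(x) = B(x,y)·(x−y)`
with `|B| ≤ ‖∇A‖_{L^∞}`"). [cite: AlinhacHPDE2009, Lemma 7.12] -/
theorem integral_sq_norm_commutator_le {ε : ℝ} (hε : 0 < ε) {a : E → ℝ} (ha : Continuous a)
    {f : E → F} (hf : MemLp f 2 volume) (haf : LocallyIntegrable (fun y => a y • f y) volume)
    {L : ℝ} (hL0 : 0 ≤ L)
    (hL : ∀ x y, y ∈ tsupport f → ‖x - y‖ < 2 * ε → ‖a y - a x‖ ≤ L * ‖x - y‖) :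
    Integrable (fun x => ‖mollify ε (fun y => a y • f y) x - a x • mollify ε f x‖ ^ 2) volume ∧
      ∫ x, ‖mollify ε (fun y => a y • f y) x - a x • mollify ε f x‖ ^ 2 ≤
        (2 * ε * L) ^ 2 * ∫ y, ‖f y‖ ^ 2 := by
  have hfl : LocallyIntegrable f volume := hf.locallyIntegrable one_le_two
  -- the dominating kernel `2εL ρ_ε`
  set k : E → ℝ := fun z => (2 * ε * L) * mollifier ε z with hk
  have hkc' : Continuous k := continuous_const.mul (continuous_mollifier ε)
  have hks : HasCompactSupport k := (hasCompactSupport_mollifier ε).mul_left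
  have hk0 : ∀ z, 0 ≤ k z := fun z => mul_nonneg (by positivity) (mollifier_nonneg ε z)
  have hkint : ∫ z, k z = 2 * ε * L := by
    rw [hk]; simp only
    rw [integral_const_mul, integral_mollifier, mul_one]
  -- measurability of the commutator
  have hg : AEStronglyMeasurable
      (fun x => mollify ε (fun y => a y • f y) x - a x • mollify ε f x) volume :=
    ((continuous_mollify ε haf).sub (ha.smul (continuous_mollify ε hfl))).aestronglyMeasurable
  -- pointwise domination
  have hdom : ∀ x, ‖mollify ε (fun y => a y • f y) x - a x • mollify ε f x‖ ≤
      (k ⋆[lsmul ℝ ℝ, volume] fun y => ‖f y‖) x := by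
    intro x
    rw [mollify_smul_sub_smul_mollify ε hfl haf x, convolution_lsmul_swap]
    have hρx : Continuous fun y : E => k (x - y) := hkc'.comp (continuous_const.sub continuous_id)
    have hρxc : HasCompactSupport fun y : E => k (x - y) :=
      hks.comp_homeomorph (Homeomorph.subLeft x)
    have hfln : LocallyIntegrable (fun y => ‖f y‖) volume :=
      hfl.mono hfl.aestronglyMeasurable.norm (ae_of_all _ fun y => by simp)
    have hint : Integrable (fun y => k (x - y) * ‖f y‖) volume :=
      hfln.integrable_smul_left_of_hasCompactSupport hρx hρxc
    calc ‖∫ y, (mollifier ε (x - y) * (a y - a x)) • f y‖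
        ≤ ∫ y, k (x - y) * ‖f y‖ := by
          refine norm_integral_le_of_norm_le hint (ae_of_all _ fun y => ?_)
          by_cases hy : y ∈ tsupport f
          · rw [norm_smul, norm_mul, Real.norm_of_nonneg (mollifier_nonneg ε _)]
            refine mul_le_mul_of_nonneg_right ?_ (norm_nonneg _)
            -- either `ρ_ε(x - y) = 0`, or `‖x - y‖ < 2ε` and the Lipschitz bound applies
            by_cases hρ0 : mollifier ε (x - y) = 0
            · simp [hρ0, hk]
            · have hxy : ‖x - y‖ < 2 * ε := by
                have hmem : x - y ∈ support (mollifier ε : E → ℝ) := hρ0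
                rw [support_mollifier hε, mem_ball_zero_iff] at hmem
                exact hmem
              have h1 := hL x y hy hxy
              rw [hk]
              calc mollifier ε (x - y) * ‖a y - a x‖
                  ≤ mollifier ε (x - y) * (L * (2 * ε)) := by
                    refine mul_le_mul_of_nonneg_left (h1.trans ?_) (mollifier_nonneg ε _)
                    exact mul_le_mul_of_nonneg_left hxy.le hL0
                _ = 2 * ε * L * mollifier ε (x - y) := by ring
          · -- off the support of `f` both sides vanish
            have hfy : f y = 0 := image_eq_zero_of_notMem_tsupport hy
            simp [hfy]
      _ = ∫ y, k (x - y) • ‖f y‖ := by simp only [smul_eq_mul]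
  obtain ⟨hi, hle⟩ := integral_sq_norm_le_of_norm_le_convolution hkc' hks hk0 hf hg hdom
  exact ⟨hi, by rwa [hkint] at hle⟩

end Literature.Analysis.Convolution

end
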